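import Summits.MatrixMultiplication.OmegaCensus.C2Quaternion16ShapeFCoset
import HarnessLib

/-!
# Dicyclic type, `|A| = 16`: descent case of the shape `(1,2 | 1,2 | 2,2)` (abstract form of `no_36_shape_f_coset`)

ω-census, family (b3).  Framing: lottery ticket; floor = certified bounds/negative ranges.
-/

namespace Summit.MatrixMultiplication.OmegaCensus

open Literature.Combinatorics.Additive Finset

section Coset

variable {A : Type*} [AddCommGroup A] [DecidableEq A] [Fintype A] {G : Type} [Group G] [DecidableEq G]
  {ρ τ : A → G} {c₀ : A} {S T U : Finset G} {Q : Type*} [AddCommGroup Q] [DecidableEq Q]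

/-- **Descent case of the shape `(1,2 | 1,2 | 2,2)`**: if `U₀` and `U₁` are both `⟨c₀⟩`-invariant, no such TPP triple
exists in dicyclic type over `A`, `|A| = 16`, with a projection `π` as in `no_36_shape_d_abs`. [folklore] -/
theorem no_36_shape_f_coset_abs
    (hρρ : ∀ a b, ρ a * ρ b = ρ (a + b)) (hρτ : ∀ a b, ρ a * τ b = τ (b - a))
    (hτρ : ∀ a b, τ a * ρ b = τ (a + b))
    (hττ : ∀ a b, τ a * τ b = ρ (c₀ + b - a))
    (hρ : Function.Injective ρ) (hτ : Function.Injective τ) (hne : ∀ a b, ρ a ≠ τ b)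
    (h : TripleProductProperty S T U)
    (hs₀ : (univ.filter fun a : A => ρ a ∈ S).card = 1)
    (hs₁ : (univ.filter fun a : A => τ a ∈ S).card = 2)
    (ht₀ : (univ.filter fun a : A => ρ a ∈ T).card = 1)
    (ht₁ : (univ.filter fun a : A => τ a ∈ T).card = 2)
    (hU₀c : ∀ z ∈ (univ.filter fun a : A => ρ a ∈ U), z + c₀ ∈
      (univ.filter fun a : A => ρ a ∈ U))
    (hU₁c : ∀ z ∈ (univ.filter fun a : A => τ a ∈ U), z + c₀ ∈
      (univ.filter fun a : A => τ a ∈ U))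
    (hU₀ne : (univ.filter fun a : A => ρ a ∈ U).Nonempty)
    (hU₁ne : (univ.filter fun a : A => τ a ∈ U).Nonempty)
    (π : A →+ Q) (hπ : ∀ X Y : A, π X = π Y ↔ (Y = X ∨ Y = X + c₀))
    (hQ : ∀ d e a b : Q, d ≠ 0 → e ≠ 0 → d ≠ e → d + e ≠ 0 →
      a ∉ ({0, d, e, d + e} : Finset Q) → a + e ∉ ({0, d, e, d + e} : Finset Q) →
      b ∉ ({0, d, e, d + e} : Finset Q) → b + d ∉ ({0, d, e, d + e} : Finset Q) →
      a ≠ b → a ≠ b + d → a + e ≠ b → a + e ≠ b + d → False) : False := by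
  have h2c : c₀ + c₀ = 0 := two_c0_eq_zero hρτ hτρ hττ hτ
  set S₀ : Finset (A) := univ.filter fun a => ρ a ∈ S with hS₀
  set S₁ : Finset (A) := univ.filter fun a => τ a ∈ S with hS₁
  set T₀ : Finset (A) := univ.filter fun a => ρ a ∈ T with hT₀
  set T₁ : Finset (A) := univ.filter fun a => τ a ∈ T with hT₁
  set U₀ : Finset (A) := univ.filter fun a => ρ a ∈ U with hU₀
  set U₁ : Finset (A) := univ.filter fun a => τ a ∈ U with hU₁
  have mS₀ : ∀ a ∈ S₀, cond false (τ a) (ρ a) ∈ S := fun a ha => by simpa [hS₀] using ha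
  have mS₁ : ∀ a ∈ S₁, cond true (τ a) (ρ a) ∈ S := fun a ha => by simpa [hS₁] using ha
  have mT₀ : ∀ a ∈ T₀, cond false (τ a) (ρ a) ∈ T := fun a ha => by simpa [hT₀] using ha
  have mT₁ : ∀ a ∈ T₁, cond true (τ a) (ρ a) ∈ T := fun a ha => by simpa [hT₁] using ha
  have mU₀ : ∀ a ∈ U₀, cond false (τ a) (ρ a) ∈ U := fun a ha => by simpa [hU₀] using ha
  have mU₁ : ∀ a ∈ U₁, cond true (τ a) (ρ a) ∈ U := fun a ha => by simpa [hU₁] using ha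
  have inj := sum_injOn' hρρ hττ hρ hτ h
  obtain ⟨a₀, hS₀a⟩ := card_eq_one.1 hs₀
  obtain ⟨t, hT₀t⟩ := card_eq_one.1 ht₀
  obtain ⟨s₁, s₂, hs12, hS₁eq⟩ := card_eq_two.1 hs₁
  obtain ⟨t₁, t₂, ht12, hT₁eq⟩ := card_eq_two.1 ht₁
  have hs₁m : s₁ ∈ S₁ := by rw [hS₁eq]; simp
  have hs₂m : s₂ ∈ S₁ := by rw [hS₁eq]; simp
  have ht₁m : t₁ ∈ T₁ := by rw [hT₁eq]; simp
  have ht₂m : t₂ ∈ T₁ := by rw [hT₁eq]; simp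
  obtain ⟨u₁, hu₁⟩ := hU₀ne
  obtain ⟨v₁, hv₁⟩ := hU₁ne
  have absU₀ : ∀ z ∈ U₀, ∀ κ : A, (κ = 0 ∨ κ = c₀) → z + κ ∈ U₀ := by
    rintro z hz κ (hk | hk) <;> subst κ
    · rw [add_zero]; exact hz
    · exact hU₀c z hz
  have absU₁ : ∀ z ∈ U₁, ∀ κ : A, (κ = 0 ∨ κ = c₀) → z + κ ∈ U₁ := by
    rintro z hz κ (hk | hk) <;> subst κ
    · rw [add_zero]; exact hz
    · exact hU₁c z hz
  -- boxes of the vertex `111`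
  set X := (S₁ ×ˢ T₁ ×ˢ U₀).image fun p : (A) × (A) × (A) =>
    p.1 + p.2.1 + p.2.2 with hX
  set Y := (S₁ ×ˢ T₀ ×ˢ U₁).image fun p : (A) × (A) × (A) =>
    p.1 + p.2.1 + p.2.2 with hY
  set Z := (S₀ ×ˢ T₁ ×ˢ U₁).image fun p : (A) × (A) × (A) =>
    p.1 + p.2.1 + p.2.2 with hZ
  have dYZ : Disjoint Y Z := (disjoint_sumset₁' hρρ hρτ hτρ hττ hne h) true mS₁ mT₀ mU₁ mS₀ mT₁
  have dXY : Disjoint X Y := (disjoint_sumset₂' hρρ hρτ hτρ hττ hne h) true mS₁ mT₁ mU₀ mS₁ mT₀ mU₁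
  have dZX : Disjoint Z X := (disjoint_sumset₃' hρρ hρτ hτρ hττ hne h) true mS₀ mT₁ mU₁ mS₁ mU₀
  have mX : ∀ a ∈ S₁, ∀ b ∈ T₁, ∀ c ∈ U₀, a + b + c ∈ X := fun a ha b hb c hc => by
    rw [hX]; exact mem_sumset₃.2 ⟨a, ha, b, hb, c, hc, rfl⟩
  have mY : ∀ a ∈ S₁, ∀ c ∈ U₁, a + t + c ∈ Y := fun a ha c hc => by
    rw [hY]; exact mem_sumset₃.2 ⟨a, ha, t, by rw [hT₀t]; exact mem_singleton_self _, c, hc, rfl⟩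
  have mZ : ∀ b ∈ T₁, ∀ c ∈ U₁, a₀ + b + c ∈ Z := fun b hb c hc => by
    rw [hZ]; exact mem_sumset₃.2 ⟨a₀, by rw [hS₀a]; exact mem_singleton_self _, b, hb, c, hc, rfl⟩
  have iX := triple_of_sum_injOn (inj true true false mS₁ mT₁ mU₀)
  have htm : t ∈ T₀ := by rw [hT₀t]; exact mem_singleton_self _
  have iY := triple_of_sum_injOn (inj true false true mS₁ mT₀ mU₁)
  have iZ := pairs_of_sum_injOn_fst (by rw [← hS₀a]; exact inj false true true mS₀ mT₁ mU₁)
  -- the parts `S₁`, `T₁` are not periodic (else two periodic factors in an injective box)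
  have hdT : t₂ - t₁ ≠ c₀ := by
    intro hh
    have := iZ t₁ ht₁m t₂ ht₂m (v₁ + c₀) (hU₁c v₁ hv₁) v₁ hv₁ (by rw [← hh]; abel)
    exact ht12 this.1
  have hdS : s₂ - s₁ ≠ c₀ := by
    intro hh
    have := iY s₁ hs₁m s₂ hs₂m t htm t htm (v₁ + c₀) (hU₁c v₁ hv₁) v₁ hv₁ (by rw [← hh]; abel)
    exact hs12 this.1
  -- projection
  have keyκ : ∀ P Q : A, π P = π Q → ∃ κ, (κ = 0 ∨ κ = c₀) ∧ Q = P + κ := by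
    intro P Q hPQ
    rcases (hπ P Q).1 hPQ with e | e
    · exact ⟨0, Or.inl rfl, by rw [add_zero]; exact e⟩
    · exact ⟨c₀, Or.inr rfl, e⟩
  have key0 : ∀ P : A, π P = 0 → ∃ κ, (κ = 0 ∨ κ = c₀) ∧ P = κ := by
    intro P hP
    obtain ⟨κ, hκ, e⟩ := keyκ 0 P (by rw [map_zero, hP])
    exact ⟨κ, hκ, by rw [e, zero_add]⟩
  -- clashes
  have clashXY : ∀ a ∈ S₁, ∀ b ∈ T₁, ∀ c ∈ U₀, ∀ a' ∈ S₁, ∀ c' ∈ U₁, ∀ κ : A,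
      (κ = 0 ∨ κ = c₀) → a' + t + c' = a + b + c + κ → False := by
    intro a ha b hb c hc a' ha' c' hc' κ hκ e
    refine disjoint_left.1 dXY ?_ (mY a' ha' c' hc')
    rw [e, show a + b + c + κ = a + b + (c + κ) by abel]; exact mX a ha b hb _ (absU₀ c hc κ hκ)
  have clashXZ : ∀ a ∈ S₁, ∀ b ∈ T₁, ∀ c ∈ U₀, ∀ b' ∈ T₁, ∀ c' ∈ U₁, ∀ κ : A,
      (κ = 0 ∨ κ = c₀) → a₀ + b' + c' = a + b + c + κ → False := by
    intro a ha b hb c hc b' hb' c' hc' κ hκ e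
    refine disjoint_left.1 dZX (mZ b' hb' c' hc') ?_
    rw [e, show a + b + c + κ = a + b + (c + κ) by abel]; exact mX a ha b hb _ (absU₀ c hc κ hκ)
  have clashYZ : ∀ b ∈ T₁, ∀ c ∈ U₁, ∀ a' ∈ S₁, ∀ c' ∈ U₁, ∀ κ : A,
      (κ = 0 ∨ κ = c₀) → a₀ + b + c = a' + t + c' + κ → False := by
    intro b hb c hc a' ha' c' hc' κ hκ e
    refine disjoint_left.1 dYZ ?_ (mZ b hb c hc)
    rw [e, show a' + t + c' + κ = a' + t + (c' + κ) by abel]; exact mY a' ha' _ (absU₁ c' hc' κ hκ)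
  refine hQ (π (t₂ - t₁)) (π (s₂ - s₁)) (π (t + v₁ - t₁ - u₁)) (π (a₀ + v₁ - s₁ - u₁))
    ?_ ?_ ?_ ?_ ?_ ?_ ?_ ?_ ?_ ?_ ?_ ?_
  · intro hh
    obtain ⟨κ, hκ, e⟩ := key0 _ hh
    rcases hκ with hk | hk <;> rw [hk] at e
    · exact ht12 (by linear_combination (norm := abel1) -e)
    · exact hdT e
  · intro hh
    obtain ⟨κ, hκ, e⟩ := key0 _ hh
    rcases hκ with hk | hk <;> rw [hk] at e
    · exact hs12 (by linear_combination (norm := abel1) -e)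
    · exact hdS e
  · intro hh
    obtain ⟨κ, hκ, e⟩ := keyκ _ _ hh
    exact hs12.symm (iX s₂ hs₂m s₁ hs₁m t₁ ht₁m t₂ ht₂m u₁ hu₁ (u₁ + κ) (absU₀ u₁ hu₁ κ hκ)
      (by linear_combination (norm := abel1) e)).1
  · intro hh
    rw [← map_add] at hh
    obtain ⟨κ, hκ, e⟩ := key0 _ hh
    exact hs12.symm (iX s₂ hs₂m s₁ hs₁m t₂ ht₂m t₁ ht₁m u₁ hu₁ (u₁ + κ) (absU₀ u₁ hu₁ κ hκ)
      (by linear_combination (norm := abel1) e)).1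
  · intro hh
    simp only [mem_insert, mem_singleton, ← map_add] at hh
    rcases hh with hh | hh | hh | hh
    · obtain ⟨κ, hκ, e⟩ := key0 _ hh
      exact clashXY s₁ hs₁m t₁ ht₁m u₁ hu₁ s₁ hs₁m v₁ hv₁ κ hκ (by linear_combination (norm := abel1) e)
    · obtain ⟨κ, hκ, e⟩ := keyκ _ _ hh.symm
      exact clashXY s₁ hs₁m t₂ ht₂m u₁ hu₁ s₁ hs₁m v₁ hv₁ κ hκ (by linear_combination (norm := abel1) e)
    · obtain ⟨κ, hκ, e⟩ := keyκ _ _ hh.symm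
      exact clashXY s₂ hs₂m t₁ ht₁m u₁ hu₁ s₁ hs₁m v₁ hv₁ κ hκ (by linear_combination (norm := abel1) e)
    · obtain ⟨κ, hκ, e⟩ := keyκ _ _ hh.symm
      exact clashXY s₂ hs₂m t₂ ht₂m u₁ hu₁ s₁ hs₁m v₁ hv₁ κ hκ (by linear_combination (norm := abel1) e)
  · intro hh
    simp only [mem_insert, mem_singleton, ← map_add] at hh
    rcases hh with hh | hh | hh | hh
    · obtain ⟨κ, hκ, e⟩ := key0 _ hh
      exact clashXY s₁ hs₁m t₁ ht₁m u₁ hu₁ s₂ hs₂m v₁ hv₁ κ hκ (by linear_combination (norm := abel1) e)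
    · obtain ⟨κ, hκ, e⟩ := keyκ _ _ hh.symm
      exact clashXY s₁ hs₁m t₂ ht₂m u₁ hu₁ s₂ hs₂m v₁ hv₁ κ hκ (by linear_combination (norm := abel1) e)
    · obtain ⟨κ, hκ, e⟩ := keyκ _ _ hh.symm
      exact clashXY s₂ hs₂m t₁ ht₁m u₁ hu₁ s₂ hs₂m v₁ hv₁ κ hκ (by linear_combination (norm := abel1) e)
    · obtain ⟨κ, hκ, e⟩ := keyκ _ _ hh.symm
      exact clashXY s₂ hs₂m t₂ ht₂m u₁ hu₁ s₂ hs₂m v₁ hv₁ κ hκ (by linear_combination (norm := abel1) e)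
  · intro hh
    simp only [mem_insert, mem_singleton, ← map_add] at hh
    rcases hh with hh | hh | hh | hh
    · obtain ⟨κ, hκ, e⟩ := key0 _ hh
      exact clashXZ s₁ hs₁m t₁ ht₁m u₁ hu₁ t₁ ht₁m v₁ hv₁ κ hκ (by linear_combination (norm := abel1) e)
    · obtain ⟨κ, hκ, e⟩ := keyκ _ _ hh.symm
      exact clashXZ s₁ hs₁m t₂ ht₂m u₁ hu₁ t₁ ht₁m v₁ hv₁ κ hκ (by linear_combination (norm := abel1) e)
    · obtain ⟨κ, hκ, e⟩ := keyκ _ _ hh.symm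
      exact clashXZ s₂ hs₂m t₁ ht₁m u₁ hu₁ t₁ ht₁m v₁ hv₁ κ hκ (by linear_combination (norm := abel1) e)
    · obtain ⟨κ, hκ, e⟩ := keyκ _ _ hh.symm
      exact clashXZ s₂ hs₂m t₂ ht₂m u₁ hu₁ t₁ ht₁m v₁ hv₁ κ hκ (by linear_combination (norm := abel1) e)
  · intro hh
    simp only [mem_insert, mem_singleton, ← map_add] at hh
    rcases hh with hh | hh | hh | hh
    · obtain ⟨κ, hκ, e⟩ := key0 _ hh
      exact clashXZ s₁ hs₁m t₁ ht₁m u₁ hu₁ t₂ ht₂m v₁ hv₁ κ hκ (by linear_combination (norm := abel1) e)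
    · obtain ⟨κ, hκ, e⟩ := keyκ _ _ hh.symm
      exact clashXZ s₁ hs₁m t₂ ht₂m u₁ hu₁ t₂ ht₂m v₁ hv₁ κ hκ (by linear_combination (norm := abel1) e)
    · obtain ⟨κ, hκ, e⟩ := keyκ _ _ hh.symm
      exact clashXZ s₂ hs₂m t₁ ht₁m u₁ hu₁ t₂ ht₂m v₁ hv₁ κ hκ (by linear_combination (norm := abel1) e)
    · obtain ⟨κ, hκ, e⟩ := keyκ _ _ hh.symm
      exact clashXZ s₂ hs₂m t₂ ht₂m u₁ hu₁ t₂ ht₂m v₁ hv₁ κ hκ (by linear_combination (norm := abel1) e)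
  · intro hh
    obtain ⟨κ, hκ, e⟩ := keyκ _ _ hh
    exact clashYZ t₁ ht₁m v₁ hv₁ s₁ hs₁m v₁ hv₁ κ hκ (by linear_combination (norm := abel1) e)
  · intro hh
    rw [← map_add] at hh
    obtain ⟨κ, hκ, e⟩ := keyκ _ _ hh
    exact clashYZ t₂ ht₂m v₁ hv₁ s₁ hs₁m v₁ hv₁ κ hκ (by linear_combination (norm := abel1) e)
  · intro hh
    rw [← map_add] at hh
    obtain ⟨κ, hκ, e⟩ := keyκ _ _ hh
    exact clashYZ t₁ ht₁m v₁ hv₁ s₂ hs₂m v₁ hv₁ κ hκ (by linear_combination (norm := abel1) e)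
  · intro hh
    rw [← map_add, ← map_add] at hh
    obtain ⟨κ, hκ, e⟩ := keyκ _ _ hh
    exact clashYZ t₂ ht₂m v₁ hv₁ s₂ hs₂m v₁ hv₁ κ hκ (by linear_combination (norm := abel1) e)

end Coset

end Summit.MatrixMultiplication.OmegaCensus
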